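/-
Copyright (c) 2026 the pub-hodgecm-mathlib formalisation cell (harness21).  Prover seat hodgecm-mathlib-LD1-p02 (g0), organ payer of half-A
line LD1 on loan to LD2 (organ C₂at′ `ArchSignAt₂'`, dealer LD2-plan (g0) 2026-09-02T03:17:52Z), brick (β), 2026-09-02.
THEOREMS ONLY (no definition, no named fact, no `sorry`, no instance, no notation).  `--supports stmt-HodgeConjecture-24832 --as helper`.
-/
import Literature.NumberTheory.Automorphic.Liu2021.ThetaLiftFromLineFrameArchProj
import Summits.HodgeConjecture.HodgeConjecture.Theorems.F0LD2FrameTransportPin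
import HarnessLib

/-!
# C₂at′ brick (β): the PINNED transport `ιA` carries the one-place element `adelicSingle_H w₀ (σ_{w₀}(g)·u·σ_{w₀}(g)⁻¹)` of
# `U(H)(𝔸_{L⁺})` to the one-place element `adelicSingle_{diag dV} w₀ u` of `U(diag dV)(𝔸_{L⁺})`

Cell hodgecm-mathlib FLOOR 0, programme P6, half-A line LD (crux `hLiu418` = `stmt-HodgeConjecture-24832`), organ C₂at′ `ArchSignAt₂'` of the LD2
skeleton of record v5 (`F0/P6/LD/LD2-plan/g0/StubS1bfacts.inhouse.skeleton.v5.lean` sha16 e8da573259aec245 :325–:356).  Namespace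
`Summit.HodgeConjecture.HodgeConjecture.Cruxes.HLiu418.F0LD2PinnedArchSingleTransport`.

The organs of the LD skeletons speak of an ABSTRACT transport `ιA : U(H)(𝔸_{L⁺}) →* U(diag dV)(𝔸_{L⁺})` PINNED only by its matrix
`↑(ιA k) = g_𝔸⁻¹ · k · g_𝔸` under the SCALED frame `ᵗ(c̄ g) · (t • H) · g = diag dV` (`t ≠ 0`).  ★ `F0LD2FrameTransportPin.pin_apply` identifies
`ιA` with `cmAdelicFrameTransport L N (t • H) dV g _` on `U(H)(𝔸) = U(t • H)(𝔸)`; ★ `ThetaLiftFromLineFrameArchSingle` §1 and ★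
`ThetaLiftFromLineFrameArchProj` §3 (any `N`, any frame) say that `adelicSingle w₀ u` is that transport of an archimedean element of `U(t • H)(𝔸)`
trivial away from `w₀` with `w₀`-component `σ_{w₀}(g) · u · σ_{w₀}(g)⁻¹`.  This file rewrites that element as the one-place element
`adelicSingle_H w₀ γ` of `U(H)(𝔸)` (group bookkeeping `G(𝔸) = G_∞ × G(𝔸_f)`, `G_∞ = ∏_w G(L⁺_w)`, [BorelJacquet1979, §4.1]) — the form in
which the C₂at′ closer moves the archimedean Weil action at the place of `ι` across the pairing `⟨f, Θ ∘ ιA⟩` (the hol side acts by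
`R(adelicSingle_H w₀ γ)`, ★ `F0LD2ConeTorusCovariance`; the theta side by `R(adelicSingle_{dV} w₀ u)`, ★ `ThetaLiftFromLineTorusCovariance`).

* `archAt_eq_one_iff_eq_archSingle` (§1): an archimedean element is `archSingle w₀ (a_{w₀})` iff its components away from `w₀` are trivial;
* `exists_archLocal_pin_adelicSingle_eq` (§2): **∃ γ ∈ U(σ_{w₀} H)(ℂ), ιA (adelicSingle_H w₀ γ) = adelicSingle_{dV} w₀ u ∧ ↑γ = σ_{w₀}(g)·u·σ_{w₀}(g)⁻¹**;
* `pin_adelicSingle_eq_of_coe_eq` (§2): conversely the pinned transport of `adelicSingle_H w₀ γ` with `↑γ = σ_{w₀}(g)·u·σ_{w₀}(g)⁻¹` IS `adelicSingle_{dV} w₀ u`.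

HONEST SCOPE.  Group bookkeeping only; nothing of [Liu2021] is asserted, nothing archimedean is computed.  HC_CM is proved only modulo the
printed citations until rung 0 closes; this file books nothing and discharges nothing booked.

## References
* [BorelJacquet1979] A. Borel, H. Jacquet, PSPM 33.1 (1979), §4.1 (`G(𝔸) = G_∞ × G(𝔸_f)`, `G_∞ = ∏_{v ∣ ∞} G(F_v)`).
* [PlatonovRapinchuk1994] V. Platonov, A. Rapinchuk, *Algebraic Groups and Number Theory* (1994), §2.3, §5.1.
* [Liu2021] Y. Liu, arXiv:2102.11518, proof of Prop. 4.13 Case 1 (l. 2137–2141, p. 48); App. D Lem. D.2 (p. 127–128).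
-/

set_option autoImplicit false
set_option linter.dupNamespace false

noncomputable section

open NumberField NumberField.InfinitePlace NumberField.mixedEmbedding IsDedekindDomain
open scoped Matrix

namespace Summit.HodgeConjecture.HodgeConjecture.Cruxes.HLiu418.F0LD2PinnedArchSingleTransport

open Literature.NumberTheory.Automorphic Literature.NumberTheory.Automorphic.UnitaryGroup
open Literature.NumberTheory.Automorphic.Liu2021
open Literature.NumberTheory.GelbartRogawski1991
open Summit.HodgeConjecture.HodgeConjecture.Cruxes.HLiu418.F0LD2ArchAdmissibleAssembly (frame_smul_eq)
open Summit.HodgeConjecture.HodgeConjecture.Cruxes.HLiu418.F0LD2FrameTransportPin (adelic_smul_eq pin_apply)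

/-! ## §1 Archimedean elements trivial away from one place -/

section Arch

variable (F E : Type) [Field F] [NumberField F] [Field E] [NumberField E] [Algebra F E] (c : E ≃ₐ[F] E) (N : ℕ)
  (J : Matrix (Fin N) (Fin N) E) (hc : c ≠ 1) (hfix : ∀ w : InfinitePlace E, c • w = w) (w₁ : {w : InfinitePlace E // IsComplex w})

omit [NumberField F] [NumberField E] in
/-- **An archimedean element whose components away from `w₁` are trivial IS `archSingle w₁ (its w₁-component)`** (`G_∞ = ∏_w G(F_w)`:
★ `archPiEquiv` is a bijection onto the product and `archSingle w₁ = archPiEquiv⁻¹ ∘ Pi.mulSingle w₁`). [cite: BorelJacquet1979, §4.1] -/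
theorem eq_archSingle_archAt_of_archAt_eq_one (a : arch F E c N J)
    (ha : ∀ w : {w : InfinitePlace E // IsComplex w}, w ≠ w₁ → archAt F E c N J w (hfix w.1) hc a = 1) :
    a = archSingle F E c N J hc hfix w₁ (archAt F E c N J w₁ (hfix w₁.1) hc a) := by
  classical
  apply (archPiEquiv F E c N J hc hfix).injective
  funext w
  rw [archPiEquiv_apply, archPiEquiv_apply, UnitaryGroup.archSingle_apply, archAt_archPiEquiv_symm]
  by_cases hw : w = w₁
  · subst hw; rw [Pi.mulSingle_eq_same]
  · rw [Pi.mulSingle_eq_of_ne hw, ha w hw]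

/-- **An adelic element with trivial finite part and trivial archimedean components away from `w₁` IS the one-place element
`adelicSingle w₁ (its w₁-component)`** (`G(𝔸) = G_∞ × G(𝔸_f)` ★ `archToAdelic_mul_finAdelicToAdelic`, and §1). [cite: BorelJacquet1979, §4.1] -/
theorem eq_adelicSingle_of_finPart_eq_one_of_archAt_eq_one (k : (adelicGroupData F E c N J).Adelic) (hfin : finPart F E c N J k = 1)
    (ha : ∀ w : {w : InfinitePlace E // IsComplex w}, w ≠ w₁ → archAt F E c N J w (hfix w.1) hc (archPart F E c N J k) = 1) :
    k = adelicSingle F E c N J hc hfix w₁ (archAt F E c N J w₁ (hfix w₁.1) hc (archPart F E c N J k)) := by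
  have h := archToAdelic_mul_finAdelicToAdelic F E c N J k
  rw [hfin, map_one, mul_one] at h
  rw [adelicSingle_apply, ← eq_archSingle_archAt_of_archAt_eq_one F E c N J hc hfix w₁ _ ha, h]

end Arch

/-! ## §2 The pinned transport of one-place elements -/

section Pin

variable (L : Type) [Field L] [NumberField L] [IsCMField L] (N : ℕ) (H : Matrix (Fin N) (Fin N) L) (dV : Fin N → L)
  (t : L) (ht : t ≠ 0) (g : GL (Fin N) L)
  (hg : formCongr ((IsCMField.complexConj L : L ≃ₐ[↥(maximalRealSubfield L)] L) : L →+* L) g (t • H) = Matrix.diagonal dV)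
  (ιA : (adelicGroupData (↥(maximalRealSubfield L)) L (IsCMField.complexConj L) N H).Adelic →*
    ↥(UnitaryGroup.adelic (↥(maximalRealSubfield L)) L (IsCMField.complexConj L) N (Matrix.diagonal dV)))
  (hιA : ∀ k, ((ιA k : ↥(UnitaryGroup.adelic (↥(maximalRealSubfield L)) L (IsCMField.complexConj L) N (Matrix.diagonal dV))) :
      GL (Fin N) (AdeleRing (𝓞 L) L)) =
    (toAdeleGL L g)⁻¹ * adelicVal (↥(maximalRealSubfield L)) L (IsCMField.complexConj L) N H k * toAdeleGL L g)

include ht hg hιA in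
/-- **THE ONE-PLACE ELEMENT THROUGH THE PINNED TRANSPORT.**  For a complex place `w₀` of `L` and `u ∈ U(σ_{w₀} diag dV)(ℂ)` there is
`γ ∈ U(σ_{w₀} H)(ℂ)` with `ιA (adelicSingle_H w₀ γ) = adelicSingle_{diag dV} w₀ u` and `γ = σ_{w₀}(g) · u · σ_{w₀}(g)⁻¹` as matrices: `ιA` is conjugation
by the principal adele `g_𝔸` (★ `pin_apply`), a bijection `U(H)(𝔸) = U(t•H)(𝔸) → U(diag dV)(𝔸)` compatible with `G(𝔸) = G_∞ × G(𝔸_f)` and with the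
factorisation of `G_∞` place by place (★ `exists_arch_cmAdelicFrameTransport_archToAdelic_eq_adelicSingle`, ★
`coe_archAt_eq_of_cmAdelicFrameTransport_eq_adelicSingle` for the form `t • H`, and §1). [cite: BorelJacquet1979, §4.1] [cite: PlatonovRapinchuk1994, §2.3] -/
theorem exists_archLocal_pin_adelicSingle_eq (w₀ : {w : InfinitePlace L // w.IsComplex})
    (u : UnitaryGroup.archLocal L N (Matrix.diagonal dV) w₀) :
    ∃ γ : UnitaryGroup.archLocal L N H w₀,
      ιA (UnitaryGroup.adelicSingle (↥(maximalRealSubfield L)) L (IsCMField.complexConj L) N H (IsCMField.complexConj_ne_one L)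
          (complexConj_smul_infinitePlace L) w₀ γ) =
        UnitaryGroup.adelicSingle (↥(maximalRealSubfield L)) L (IsCMField.complexConj L) N (Matrix.diagonal dV) (IsCMField.complexConj_ne_one L)
          (complexConj_smul_infinitePlace L) w₀ u ∧
      ((γ : GL (Fin N) ℂ)) =
        Matrix.GeneralLinearGroup.map w₀.1.embedding g * (u : GL (Fin N) ℂ) * (Matrix.GeneralLinearGroup.map w₀.1.embedding g)⁻¹ := by
  have hg' := frame_smul_eq L N H dV t g hg
  obtain ⟨a, ha, ha1⟩ := exists_arch_cmAdelicFrameTransport_archToAdelic_eq_adelicSingle L (t • H) dV g hg' w₀ u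
  have hmat := coe_archAt_eq_of_cmAdelicFrameTransport_eq_adelicSingle L (t • H) dV g hg' w₀ u ha
  -- the archimedean element `(a, 1_f)` of `U(t • H)(𝔸) = U(H)(𝔸)`, read in `U(H)(𝔸)`
  set k : (adelicGroupData (↥(maximalRealSubfield L)) L (IsCMField.complexConj L) N H).Adelic :=
    Subgroup.inclusion (adelic_smul_eq L N H t ht).le
      (UnitaryGroup.archToAdelic (↥(maximalRealSubfield L)) L (IsCMField.complexConj L) N (t • H) a) with hk
  have hkval : adelicVal (↥(maximalRealSubfield L)) L (IsCMField.complexConj L) N H k = GLn.ofInfinite N L a := rfl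
  -- its finite part is trivial and its archimedean components away from `w₀` are trivial
  have hfin : finPart (↥(maximalRealSubfield L)) L (IsCMField.complexConj L) N H k = 1 :=
    Subtype.ext (by rw [coe_finPart, hkval, GLn.sndHom_ofInfinite, OneMemClass.coe_one])
  have hcomp : ∀ w : {w : InfinitePlace L // w.IsComplex},
      ((archAt (↥(maximalRealSubfield L)) L (IsCMField.complexConj L) N H w (complexConj_smul_infinitePlace L w.1)
          (IsCMField.complexConj_ne_one L) (archPart (↥(maximalRealSubfield L)) L (IsCMField.complexConj L) N H k) :
            UnitaryGroup.archLocal L N H w) : GL (Fin N) ℂ) =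
        ((archAt (↥(maximalRealSubfield L)) L (IsCMField.complexConj L) N (t • H) w (complexConj_smul_infinitePlace L w.1)
          (IsCMField.complexConj_ne_one L) a : UnitaryGroup.archLocal L N (t • H) w) : GL (Fin N) ℂ) := fun w => by
    rw [coe_archAt, coe_archAt, coe_archPart, hkval, GLn.toMixed_ofInfinite]
  have haway : ∀ w : {w : InfinitePlace L // w.IsComplex}, w ≠ w₀ →
      archAt (↥(maximalRealSubfield L)) L (IsCMField.complexConj L) N H w (complexConj_smul_infinitePlace L w.1)
        (IsCMField.complexConj_ne_one L) (archPart (↥(maximalRealSubfield L)) L (IsCMField.complexConj L) N H k) = 1 := fun w hw =>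
    Subtype.ext (by rw [hcomp w, ha1 w hw]; rfl)
  refine ⟨archAt (↥(maximalRealSubfield L)) L (IsCMField.complexConj L) N H w₀ (complexConj_smul_infinitePlace L w₀.1)
      (IsCMField.complexConj_ne_one L) (archPart (↥(maximalRealSubfield L)) L (IsCMField.complexConj L) N H k), ?_, ?_⟩
  · -- `adelicSingle_H w₀ γ = k` and `ιA k = cmAdelicFrameTransport (t • H) (a, 1_f) = adelicSingle_{dV} w₀ u`
    rw [← eq_adelicSingle_of_finPart_eq_one_of_archAt_eq_one (↥(maximalRealSubfield L)) L (IsCMField.complexConj L) N H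
        (IsCMField.complexConj_ne_one L) (complexConj_smul_infinitePlace L) w₀ k hfin haway,
      pin_apply L N H dV t ht g hg ιA hιA, ← ha]
    rfl
  · rw [hcomp w₀, hmat]

include ht hg hιA in
/-- **Conversely**: if `γ ∈ U(σ_{w₀} H)(ℂ)` has the matrix `σ_{w₀}(g) · u · σ_{w₀}(g)⁻¹`, then `ιA (adelicSingle_H w₀ γ) = adelicSingle_{diag dV} w₀ u`
(the `γ` of `exists_archLocal_pin_adelicSingle_eq` is unique: the coercion `U(σ_{w₀} H)(ℂ) → GL_N(ℂ)` is injective). [cite: BorelJacquet1979, §4.1] -/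
theorem pin_adelicSingle_eq_of_coe_eq (w₀ : {w : InfinitePlace L // w.IsComplex})
    (u : UnitaryGroup.archLocal L N (Matrix.diagonal dV) w₀) (γ : UnitaryGroup.archLocal L N H w₀)
    (hγ : ((γ : GL (Fin N) ℂ)) =
      Matrix.GeneralLinearGroup.map w₀.1.embedding g * (u : GL (Fin N) ℂ) * (Matrix.GeneralLinearGroup.map w₀.1.embedding g)⁻¹) :
    ιA (UnitaryGroup.adelicSingle (↥(maximalRealSubfield L)) L (IsCMField.complexConj L) N H (IsCMField.complexConj_ne_one L)
        (complexConj_smul_infinitePlace L) w₀ γ) =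
      UnitaryGroup.adelicSingle (↥(maximalRealSubfield L)) L (IsCMField.complexConj L) N (Matrix.diagonal dV) (IsCMField.complexConj_ne_one L)
        (complexConj_smul_infinitePlace L) w₀ u := by
  obtain ⟨γ', h1, h2⟩ := exists_archLocal_pin_adelicSingle_eq L N H dV t ht g hg ιA hιA w₀ u
  have hγγ' : γ = γ' := Subtype.ext (by rw [hγ, h2])
  rw [hγγ', h1]

include ht hg hιA in
/-- **The inverse direction**: for `γ ∈ U(σ_{w₀} H)(ℂ)` the pinned transport of `adelicSingle_H w₀ γ` is the one-place element
`adelicSingle_{diag dV} w₀ u` with `↑u = σ_{w₀}(g)⁻¹ · γ · σ_{w₀}(g)` (conjugation by `σ_{w₀}(g)` is a bijection `U(σ_{w₀} H)(ℂ) → U(σ_{w₀} diag dV)(ℂ)`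
because `σ_{w₀}(t) • σ_{w₀}(diag dV) = ᵗ(σ̄_{w₀} g) · σ_{w₀}(t • H) · σ_{w₀}(g)`; here obtained from §2 applied to the transported element and
injectivity of `adelicSingle`). [cite: BorelJacquet1979, §4.1] [cite: PlatonovRapinchuk1994, §2.3] -/
theorem exists_archLocal_pin_adelicSingle_eq' (w₀ : {w : InfinitePlace L // w.IsComplex}) (γ : UnitaryGroup.archLocal L N H w₀)
    (u : UnitaryGroup.archLocal L N (Matrix.diagonal dV) w₀)
    (hu : ((u : GL (Fin N) ℂ)) =
      (Matrix.GeneralLinearGroup.map w₀.1.embedding g)⁻¹ * (γ : GL (Fin N) ℂ) * Matrix.GeneralLinearGroup.map w₀.1.embedding g) :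
    ιA (UnitaryGroup.adelicSingle (↥(maximalRealSubfield L)) L (IsCMField.complexConj L) N H (IsCMField.complexConj_ne_one L)
        (complexConj_smul_infinitePlace L) w₀ γ) =
      UnitaryGroup.adelicSingle (↥(maximalRealSubfield L)) L (IsCMField.complexConj L) N (Matrix.diagonal dV) (IsCMField.complexConj_ne_one L)
        (complexConj_smul_infinitePlace L) w₀ u :=
  pin_adelicSingle_eq_of_coe_eq L N H dV t ht g hg ιA hιA w₀ u γ (by rw [hu]; group)

end Pin

end Summit.HodgeConjecture.HodgeConjecture.Cruxes.HLiu418.F0LD2PinnedArchSingleTransport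

end
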